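import Summits.MatrixMultiplication.OmegaCensus.SmallFormats.RankOnePlaneCapColBlocks
import Summits.MatrixMultiplication.OmegaCensus.SmallFormats.MatMul223RankGF3
import Summits.MatrixMultiplication.OmegaCensus.SmallFormats.RankRowIncrement
import HarnessLib

/-!
# ω-census family (a): the LATTICE law of a saturated row plane against a saturated column plane

Cell `pub-omega` (unit `pub-omega-tensor`, gen 29), topic `Summits/MatrixMultiplication/OmegaCensus`
(sub-folder `SmallFormats`). Framing (verbatim): lottery ticket; floor = certified bounds/negative
ranges. HONEST FRAMING: the 'v1.6 lattice det-law' of the gauge-SAT instrument of the `𝔽₃`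
`⟨2,2,5⟩@17` X-marginal census (tensor-g28's kitjob-gs README: "justification = the three-line
restriction argument + the kernel bound"), written out as tree theorems. Not a bound on any rank, not
progress on `ω`.

* `bound_add_card_le_of_dualSystem` (any field, any `⟨c,m,n⟩`): if `v_a, w_b ∈ kⁿ` (`a, b < ρ`) form
  a DUAL SYSTEM (`v_a · w_b = δ_ab`) and every product `i ∈ S` either has its output killing all
  `w_b` or its Y-form killing every `Y' V` (`V` = the matrix of rows `v_a`), then the products outside
  `S` compute `⟨c,m,ρ⟩` (`Y' ↦ Y' V`, `W ↦ W B` with `B` the matrix of columns `w_b`, `V B = 1`), so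
  `b + |S| ≤ r` for any lower bound `b` of the computations of `⟨c,m,ρ⟩`.
* `bound_add_card_union_le_of_dualSystem` (`⟨2,2,n⟩`): a saturated ROW plane `R` (its Y-forms kill
  exactly the `Y` with rows in `E_row`, `card_vanishing_eq_two_mul_sub`) and a saturated COLUMN plane
  `C` (its outputs kill `E_col`, `card_vanishing_col_eq_two_mul_sub` + `mulVec_eq_zero_of_orth_iff`):
  a dual system of size `ρ` inside `E_row × E_col` costs `b_ρ + |R ∪ C| ≤ r`.
* `exists_ne_zero_dotProduct_eq_zero_of_not_dualSystem` (linear algebra): subspaces `U, V ≤ kⁿ` with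
  `dim V ≤ dim U = d` and NO dual system of size `d` have a nonzero `u ∈ U` orthogonal to `V`.
* `lattice_law_225_17_gf3` — THE LAW for `(n,r) = (5,17)` over `𝔽₃`: `dim E_row = dim E_col = 3`,
  `|R ∪ C| ≥ 7`, and `R_𝔽₃(⟨2,2,3⟩) = 11` (tree, `eleven_le_tensorRank_matMulTensor_223_gf3`) give
  `11 + 7 > 17`, so NO dual system of size 3 exists: `E_row ∩ E_col^⊥ ≠ 0` — some nonzero
  `v ∈ E_row` is orthogonal to `E_col` (equivalently `E_row^⊥ ∩ E_col ≠ 0`, the encoder's "the 2×2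
  block of the row-plane space `F = E_row^⊥` on the two coordinates of `F′ = E_col^⊥` is singular").
-/

namespace Summit.MatrixMultiplication.OmegaCensus.RankOnePlaneCapGeneral

open Module Matrix Literature.Computability.AlgebraicComplexity

universe u v

variable {k : Type u} [Field k] {c m n : ℕ} {ι : Type v} [Fintype ι]

/-! ### Restricting along a dual system -/

/-- **Restriction along a dual system.** Let `v_a, w_b ∈ kⁿ` (`a, b < ρ`) satisfy `v_a · w_b = δ_ab`.
If every product `i ∈ S` of a computation of `⟨c,m,n⟩` has either its output killing all `w_b`
(`W_i w_b = 0`) or its Y-form killing every matrix `Y' V` (`V a ν = v_a ν`), then the remaining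
products compute `⟨c,m,ρ⟩`; hence `b + |S| ≤ r` for every lower bound `b` valid for all
computations of `⟨c,m,ρ⟩` (indexed in the universe of `ι`). -/
theorem bound_add_card_le_of_dualSystem [DecidableEq ι] (β : BilinComp (mulBilin k c m n) ι)
    {ρ : ℕ} (v w : Fin ρ → Fin n → k) (hvw : ∀ a b, v a ⬝ᵥ w b = if a = b then 1 else 0)
    (S : Finset ι)
    (hS : ∀ i ∈ S, (∀ b, β.w i *ᵥ w b = 0) ∨
      ∀ Y' : Matrix (Fin m) (Fin ρ) k, β.g i (Y' * Matrix.of fun a ν => v a ν) = 0)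
    (b : ℕ) (hb : ∀ (κ : Type v) [Fintype κ], BilinComp (mulBilin k c m ρ) κ → b ≤ Fintype.card κ) :
    b + S.card ≤ Fintype.card ι := by
  classical
  set V : Matrix (Fin ρ) (Fin n) k := Matrix.of fun a ν => v a ν with hV
  set B : Matrix (Fin n) (Fin ρ) k := Matrix.of fun ν b => w b ν with hB
  have hVB : V * B = 1 := by
    ext a b'
    rw [Matrix.mul_apply, Matrix.one_apply, ← hvw a b']
    rfl
  have hdead : ∀ i ∈ S, ∀ (X : Matrix (Fin c) (Fin m) k) (Y' : Matrix (Fin m) (Fin ρ) k),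
      (β.f i X * β.g i (Y' * V)) • (β.w i * B) = 0 := by
    intro i hi X Y'
    rcases hS i hi with h | h
    · have hWB : β.w i * B = 0 := by
        ext a b'
        have h1 := congrFun (h b') a
        simpa [Matrix.mul_apply, Matrix.mulVec, dotProduct, hB] using h1
      rw [hWB, smul_zero]
    · rw [h Y', mul_zero, zero_smul]
  let β' : BilinComp (mulBilin k c m ρ) {i // i ∉ S} :=
    { f := fun i => β.f i.1
      g := fun i => (β.g i.1) ∘ₗ ((mulBilin k m ρ n).flip V)
      w := fun i => β.w i.1 * B
      map_eq_sum := fun X Y' => by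
        have h := β.map_eq_sum X (Y' * V)
        rw [mulBilin_apply] at h
        simp only [LinearMap.coe_comp, Function.comp_apply, LinearMap.flip_apply, mulBilin_apply]
        have h2 : X * Y' = X * (Y' * V) * B := by
          rw [Matrix.mul_assoc, Matrix.mul_assoc, hVB, Matrix.mul_one]
        set F : ι → Matrix (Fin c) (Fin ρ) k :=
          fun i => (β.f i X * β.g i (Y' * V)) • (β.w i * B) with hF
        have hzero : ∑ i ∈ S, F i = 0 := Finset.sum_eq_zero fun i hi => hdead i hi X Y'
        have hR : ∑ i ∈ Sᶜ, F i = ∑ i : {i // i ∉ S}, F i :=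
          Finset.sum_subtype Sᶜ (fun i => Finset.mem_compl) F
        have hlhs : (∑ i, (β.f i X * β.g i (Y' * V)) • β.w i) * B = ∑ i, F i := by
          rw [Matrix.sum_mul]
          exact Finset.sum_congr rfl fun i _ => by rw [hF, Matrix.smul_mul]
        rw [h2, h, hlhs]
        show ∑ i, F i = ∑ i : {i // i ∉ S}, F i.1
        rw [← Finset.sum_compl_add_sum S F, hzero, add_zero, hR] }
  have h := hb _ β'
  rw [Fintype.card_subtype_compl, Fintype.card_coe] at h
  have h2 : S.card ≤ Fintype.card ι := Finset.card_le_univ S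
  omega

/-- **Row plane × column plane.** In a computation of `⟨2,2,n⟩` let the Y-forms of `R` kill every
`Y` with rows in `E_row` (saturated ROW plane, `card_vanishing_eq_two_mul_sub`) and the outputs of
`C` kill `E_col` (saturated COLUMN plane, `card_vanishing_col_eq_two_mul_sub` with
`mulVec_eq_zero_of_orth_iff`). A dual system `v_a ∈ E_row`, `w_b ∈ E_col` (`a, b < ρ`,
`v_a · w_b = δ_ab`) then costs `b + |R ∪ C| ≤ r` for every lower bound `b` of `⟨2,2,ρ⟩`: restricting
`Y` to `k² ⊗ span{v_a}` kills the `R`-terms, pairing the outputs with the `w_b` kills the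
`C`-terms, and what is left computes `⟨2,2,ρ⟩`. -/
theorem bound_add_card_union_le_of_dualSystem [DecidableEq ι] (β : BilinComp (mulBilin k 2 2 n) ι)
    (R C : Finset ι) (E_row E_col : Submodule k (Fin n → k))
    (hrow : ∀ Y : Matrix (Fin 2) (Fin n) k, (∀ μ, Y μ ∈ E_row) → ∀ i ∈ R, β.g i Y = 0)
    (hcol : ∀ i ∈ C, ∀ x ∈ E_col, β.w i *ᵥ x = 0)
    {ρ : ℕ} (v w : Fin ρ → Fin n → k) (hv : ∀ a, v a ∈ E_row) (hw : ∀ b, w b ∈ E_col)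
    (hvw : ∀ a b, v a ⬝ᵥ w b = if a = b then 1 else 0)
    (b : ℕ) (hb : ∀ (κ : Type v) [Fintype κ], BilinComp (mulBilin k 2 2 ρ) κ → b ≤ Fintype.card κ) :
    b + (R ∪ C).card ≤ Fintype.card ι := by
  refine bound_add_card_le_of_dualSystem β v w hvw (R ∪ C) (fun i hi => ?_) b hb
  rcases Finset.mem_union.mp hi with h | h
  · right
    intro Y'
    refine hrow _ (fun μ => ?_) i h
    have : (Y' * Matrix.of fun a ν => v a ν) μ = ∑ a, Y' μ a • v a := by
      ext ν
      simp [Matrix.mul_apply, Finset.sum_apply, Pi.smul_apply, smul_eq_mul]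
    rw [this]
    exact Submodule.sum_mem _ fun a _ => Submodule.smul_mem _ _ (hv a)
  · left
    exact fun b' => hcol i h (w b') (hw b')

/-! ### Linear algebra: no dual system ⇒ a degenerate vector -/

/-- If `U, V ≤ kⁿ` are subspaces with `dim V ≤ dim U = d` admitting NO dual system of size `d`
(`u_a ∈ U`, `v_b ∈ V`, `u_a · v_b = δ_ab`), then some nonzero `u ∈ U` is orthogonal to all of `V`
(the pairing `U → V^*` is not injective, else it would be bijective and pull back a dual basis). -/
theorem exists_ne_zero_dotProduct_eq_zero_of_not_dualSystem (U V : Submodule k (Fin n → k))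
    {d : ℕ} (hU : finrank k U = d) (hVU : finrank k V ≤ d)
    (hno : ¬ ∃ (u v : Fin d → Fin n → k), (∀ a, u a ∈ U) ∧ (∀ b, v b ∈ V) ∧
      ∀ a b, u a ⬝ᵥ v b = if a = b then 1 else 0) :
    ∃ u ∈ U, u ≠ 0 ∧ ∀ x ∈ V, u ⬝ᵥ x = 0 := by
  classical
  by_contra hcon
  push Not at hcon
  -- the pairing `P : U → Dual V`
  let Bf : (Fin n → k) →ₗ[k] (Fin n → k) →ₗ[k] k :=
    LinearMap.mk₂ k (fun u x => u ⬝ᵥ x) (fun u₁ u₂ x => add_dotProduct u₁ u₂ x)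
      (fun a u x => by rw [smul_dotProduct, smul_eq_mul]) (fun u x₁ x₂ => dotProduct_add u x₁ x₂)
      (fun a u x => by rw [dotProduct_smul, smul_eq_mul])
  let P : U →ₗ[k] Module.Dual k V := (LinearMap.domRestrict' V) ∘ₗ (Bf.domRestrict U)
  have hP : ∀ (u : U) (x : V), P u x = (u : Fin n → k) ⬝ᵥ (x : Fin n → k) := fun u x => rfl
  have hinj : Function.Injective P := by
    rw [← LinearMap.ker_eq_bot, LinearMap.ker_eq_bot']
    intro u hu
    by_contra hne
    have hne' : (u : Fin n → k) ≠ 0 := fun h => hne (Subtype.ext h)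
    obtain ⟨x, hxV, hx⟩ := hcon u u.2 hne'
    apply hx
    have := congrArg (fun f : Module.Dual k V => f ⟨x, hxV⟩) hu
    simpa [hP] using this
  -- dimensions: `dim Dual V = dim V ≤ d = dim U`, so `P` is bijective
  have hdimV : finrank k (Module.Dual k V) = finrank k V := Subspace.dual_finrank_eq
  have hle := LinearMap.finrank_le_finrank_of_injective hinj
  have heqdim : finrank k U = finrank k (Module.Dual k V) := by omega
  have hsurj : Function.Surjective P :=
    (LinearMap.injective_iff_surjective_of_finrank_eq_finrank heqdim).mp hinj
  have hVd : finrank k V = d := by omega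
  -- pull back the dual basis of a basis of `V`
  let bV := Module.finBasisOfFinrankEq k V hVd
  have hpre : ∀ a : Fin d, ∃ u : U, P u = bV.dualBasis a := fun a => hsurj _
  choose u hu using hpre
  apply hno
  refine ⟨fun a => (u a : Fin n → k), fun b => (bV b : Fin n → k), fun a => (u a).2,
    fun b => (bV b).2, fun a b => ?_⟩
  rw [← hP, hu, Basis.dualBasis_apply_self]
  simp only [eq_comm]

/-! ### The lattice law at `(n,r) = (5,17)` over `𝔽₃` -/

/-- `R_𝔽₃(⟨2,2,3⟩) ≥ 11` in the language of bilinear computations (tree: the `𝔽₃` certificate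
`eleven_le_tensorRank_matMulTensor_223_gf3` and the bridge `RankRowIncrement.tensorRank_le_card`). -/
theorem eleven_le_card_bilinComp_223_gf3 {κ : Type v} [Fintype κ]
    (β : BilinComp (mulBilin (ZMod 3) 2 2 3) κ) : 11 ≤ Fintype.card κ :=
  le_trans SmallFormats.eleven_le_tensorRank_matMulTensor_223_gf3
    (RankRowIncrement.tensorRank_le_card β)

/-- **The lattice law** (`𝔽₃`, `⟨2,2,5⟩`, `r = 17`). Let `R` be a saturated ROW plane (`|R| = 4`; its
Y-forms kill exactly the `Y` with rows in `E_row`, `dim E_row = 3`) and `C` a saturated COLUMN plane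
(`|C| = 4`; its outputs kill `E_col`, `dim E_col = 3`) with `|R ∪ C| ≥ 7` (`|R ∩ C| ≤ 1`, automatic
for distinct X-forms). Then `E_row ∩ E_col^⊥ ≠ 0`: some nonzero `v ∈ E_row` is orthogonal to `E_col`.
(Otherwise `E_row × E_col → 𝔽₃` is a perfect pairing, a dual system of size 3 exists, and the 10
products outside `R ∪ C` would compute `⟨2,2,3⟩`, of rank 11.) Equivalently `E_row^⊥ ∩ E_col ≠ 0`:
in the gauge `E_col^⊥ = ⟨e₀,e₁⟩` the `2 × 2` block of a basis of `E_row^⊥` on the coordinates `0,1`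
is singular — the necessary constraint `JOB_LATTICE` of the encoder. -/
theorem lattice_law_225_17_gf3 {ι : Type v} [Fintype ι] [DecidableEq ι] (h17 : Fintype.card ι = 17)
    (β : BilinComp (mulBilin (ZMod 3) 2 2 5) ι) (R C : Finset ι) (hRC : 7 ≤ (R ∪ C).card)
    (E_row E_col : Submodule (ZMod 3) (Fin 5 → ZMod 3))
    (hdrow : finrank (ZMod 3) E_row = 3) (hdcol : finrank (ZMod 3) E_col = 3)
    (hrow : ∀ Y : Matrix (Fin 2) (Fin 5) (ZMod 3), (∀ μ, Y μ ∈ E_row) → ∀ i ∈ R, β.g i Y = 0)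
    (hcol : ∀ i ∈ C, ∀ x ∈ E_col, β.w i *ᵥ x = 0) :
    ∃ v ∈ E_row, v ≠ 0 ∧ ∀ x ∈ E_col, v ⬝ᵥ x = 0 := by
  refine exists_ne_zero_dotProduct_eq_zero_of_not_dualSystem E_row E_col hdrow (by omega) ?_
  rintro ⟨v, w, hv, hw, hvw⟩
  have h := bound_add_card_union_le_of_dualSystem β R C E_row E_col hrow hcol v w hv hw hvw 11
    (fun κ _ β' => eleven_le_card_bilinComp_223_gf3 β')
  omega

/-- The same law with the two plane laws' hypotheses spelled out as the tree theorems deliver them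
(`card_vanishing_eq_two_mul_sub` for the row plane `{λ zᵀ}`: the `iff` characterisation of the
common zeros of the `g_i`, `i ∈ R`, and `dim E_row + 10 = |Rᶜ|`; `card_vanishing_col_eq_two_mul_sub`
for the column plane `{z μᵀ}`: the Frobenius characterisation and `dim E_col + 10 = |Cᶜ|`),
`|R| = |C| = 4`, `|R ∩ C| ≤ 1`. -/
theorem lattice_law_225_17_gf3' {ι : Type v} [Fintype ι] [DecidableEq ι] (h17 : Fintype.card ι = 17)
    (β : BilinComp (mulBilin (ZMod 3) 2 2 5) ι) (R C : Finset ι)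
    (hR : R.card = 4) (hC : C.card = 4) (hRC : (R ∩ C).card ≤ 1)
    (E_row E_col : Submodule (ZMod 3) (Fin 5 → ZMod 3))
    (hdrow : finrank (ZMod 3) E_row + 2 * 5 = (Finset.univ \ R).card)
    (hdcol : finrank (ZMod 3) E_col + 2 * 5 = (Finset.univ \ C).card)
    (hrow : ∀ Y : Matrix (Fin 2) (Fin 5) (ZMod 3), (∀ i ∈ R, β.g i Y = 0) ↔ ∀ μ, Y μ ∈ E_row)
    (hcol : ∀ Y' : Matrix (Fin 2) (Fin 5) (ZMod 3),
      (∀ i ∈ C, (∑ κ, ∑ ν, β.w i κ ν * Y' κ ν) = 0) ↔ ∀ κ, Y' κ ∈ E_col) :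
    ∃ v ∈ E_row, v ≠ 0 ∧ ∀ x ∈ E_col, v ⬝ᵥ x = 0 := by
  have hcR : (Finset.univ \ R).card + R.card = Fintype.card ι := by
    rw [Finset.card_sdiff_add_card_eq_card (Finset.subset_univ R), Finset.card_univ]
  have hcC : (Finset.univ \ C).card + C.card = Fintype.card ι := by
    rw [Finset.card_sdiff_add_card_eq_card (Finset.subset_univ C), Finset.card_univ]
  have hU : 7 ≤ (R ∪ C).card := by
    have := Finset.card_union_add_card_inter R C
    omega
  exact lattice_law_225_17_gf3 h17 β R C hU E_row E_col (by omega) (by omega)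
    (fun Y hY i hi => (hrow Y).mpr hY i hi)
    (fun i hi x hx => mulVec_eq_zero_of_orth_iff C E_col hcol hi hx)

end Summit.MatrixMultiplication.OmegaCensus.RankOnePlaneCapGeneral
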